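import Literature.Geometry.Riemannian.HeatKernelMeasures
import Literature.Geometry.Riemannian.FamilyLaplacianRegularity
import Literature.Geometry.Riemannian.LinearHeatUniqueness
import HarnessLib

/-!
# Time regularity of the heat propagation and of the heat kernel measures
# (Bamler 2020a, §2.3: `ν_{x,t;s} → δ_x` as `s ↗ t`; continuity in the evaluation time)

For a family `h(r)` of Riemannian metrics on a closed manifold `M` (modelled on `ℝᵐ`), `C^∞` on
`M × ℝ`, the heat propagation `P_{s→t}` (`heatValue`, `heatValueC`, `HeatPropagation.lean`) and the
heat kernel measures `ν_{x,t;s}` (`heatKernelMeasure`, `HeatKernelMeasures.lean`) were built at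
fixed times `s < t`. This file proves their regularity IN THE EVALUATION TIME `s`, which Bamler
2020a, §2.3 uses in the form "`K(x,t;·,s) dg_s → δ_x` as `s ↗ t`" and which is needed to regard
`(y, s) ↦ K(x,t;y,s)` as a space-time object:

* `IsHeatSolutionOn.abs_sub_initial_le`, `abs_heatValue_sub_self_le` — **a heat solution leaves
  its smooth initial datum at most linearly**: `|(P_{s→r}φ)(x) − φ(x)| ≤ C(r − s)`,
  `C = sup |Δ_{h(·)}φ|` (weak maximum and minimum principles, `weakMaximumPrinciple` /
  `weakMinimumPrinciple`, Topping 2006 Thm. 3.1.1, for `w − φ ∓ C(r − s)`);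
* `abs_heatValue_sub_heatValue_le_of_le`, `continuous_heatValue_left`,
  `continuous_heatValueC_left` — **`s ↦ (P_{s→t}φ)(x)` is Lipschitz on compact intervals for
  smooth `φ`** (semigroup law and sup-norm contraction) **and continuous for continuous `φ`**;
* `continuous_integral_heatKernelMeasure_left` — `s ↦ ∫ φ dν_{x,t;s}` is continuous on `ℝ` for
  continuous `φ` (weak continuity of `s ↦ ν_{x,t;s}`, including `ν_{x,t;s} → δ_x` at `s = t`);
* `measurable_heatKernelMeasure_left` — `s ↦ ν_{x,t;s}` is measurable as a measure-valued map.

Everything is proved; no definitions, no named facts.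

## References

* R. H. Bamler, *Entropy and heat kernel bounds on a Ricci flow background*, arXiv:2008.07093
  (2020), §2.3 (`K(·,t;y,s) → δ_y`, `K(x,t;·,s) → δ_x`). [Bamler2020Entropy]
* R. H. Bamler, *Compactness theory of the space of super Ricci flows*, Invent. Math. 233 (2023),
  §3.1 Def. 3.2 (measurability of the kernels). [Bamler2023]
* P. Topping, *Lectures on the Ricci flow*, LMS Lecture Note Series 325, CUP 2006, Thm. 3.1.1,
  Cor. 3.1.2 (p. 35). [Topping2006]
-/

noncomputable section

open Bundle Set Function Filter Manifold MeasureTheory Measure TopologicalSpace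
open scoped Manifold ContDiff Topology ENNReal NNReal

namespace Literature.Geometry.Riemannian

open Lorentzian Lorentzian.PseudoRiemannianMetric

section TimeRegularity

variable {m : ℕ} {H : Type*} [TopologicalSpace H]
  {I : ModelWithCorners ℝ (EuclideanSpace ℝ (Fin m)) H} [I.Boundaryless]
  {M : Type*} [TopologicalSpace M] [ChartedSpace H M] [IsManifold I ∞ M]
  [T2Space M] [CompactSpace M] [SecondCountableTopology M] [MeasurableSpace M] [BorelSpace M]
  {h : ℝ → PseudoRiemannianMetric I ∞ (EuclideanSpace ℝ (Fin m)) (TangentSpace I : M → Type _)}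
  (hh : IsContMDiffFamilyOn ∞ h univ) (hR : ∀ r, (h r).IsRiemannian)

include hh in
omit [T2Space M] [CompactSpace M] [SecondCountableTopology M] [MeasurableSpace M] [BorelSpace M] in
/-- `(x, r) ↦ Δ_{h(r)} φ (x)` is continuous on `M × ℝ` for smooth `φ` and a smooth family `h`.
[folklore] -/
theorem continuous_laplaceBeltrami_family {φ : M → ℝ} (hφ : ContMDiff I 𝓘(ℝ, ℝ) ∞ φ) :
    Continuous fun p : M × ℝ ↦ (h p.2).laplaceBeltrami φ p.1 := by
  have hf : ContMDiffOn (I.prod 𝓘(ℝ, ℝ)) 𝓘(ℝ, ℝ) ∞ (fun p : M × ℝ ↦ (fun (_ : ℝ) y ↦ φ y) p.2 p.1)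
      (univ ×ˢ (univ : Set ℝ)) := (hφ.comp contMDiff_fst).contMDiffOn
  have hL := hh.contMDiffOn_laplaceBeltrami uniqueDiffOn_univ (f := fun (_ : ℝ) y ↦ φ y) hf
  rw [univ_prod_univ] at hL
  exact continuousOn_univ.1 hL.continuousOn

include hh in
omit [T2Space M] [SecondCountableTopology M] [MeasurableSpace M] [BorelSpace M] in
/-- A uniform bound `|Δ_{h(r)} φ| ≤ C` on `M × [a, b]` for smooth `φ` (compactness).
[folklore] -/
theorem exists_bound_laplaceBeltrami_family {φ : M → ℝ} (hφ : ContMDiff I 𝓘(ℝ, ℝ) ∞ φ) (a b : ℝ) :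
    ∃ C : ℝ, 0 ≤ C ∧ ∀ r ∈ Icc a b, ∀ x, |(h r).laplaceBeltrami φ x| ≤ C := by
  obtain ⟨C, hC⟩ := (isCompact_univ.prod (isCompact_Icc (a := a) (b := b))).exists_bound_of_continuousOn
    (continuous_laplaceBeltrami_family hh hφ).continuousOn
  refine ⟨max C 0, le_max_right _ _, fun r hr x ↦ ?_⟩
  have h1 := hC (x, r) ⟨mem_univ _, hr⟩
  rw [Real.norm_eq_abs] at h1
  exact h1.trans (le_max_left _ _)

include hR in
omit [T2Space M] [SecondCountableTopology M] [MeasurableSpace M] [BorelSpace M] in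
/-- **A heat solution moves away from its initial datum at most linearly in time**: if `w`
solves `∂ᵣw = Δ_{h(r)}w` on `M × [s, t]`, `s < t`, with `w(s) = φ` smooth and
`|Δ_{h(r)}φ| ≤ C` on `M × [s, t]`, then `|w(r, x) − φ(x)| ≤ C (r − s)` (the weak maximum /
minimum principles for `w − φ ∓ C(r − s)`, whose heat operator has a sign). This is the
quantitative form of `ν_{x,t;s} → δ_x` (`s ↗ t`) of Bamler 2020a, §2.3.
[cite: Topping2006, Thm. 3.1.1 and Cor. 3.1.2 (p. 35)] [cite: Bamler2020Entropy, §2.3] -/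
theorem IsHeatSolutionOn.abs_sub_initial_le {w : ℝ → M → ℝ} {s t : ℝ} (hst : s < t)
    (hw : IsHeatSolutionOn h w s t) {φ : M → ℝ} (hφ : ContMDiff I 𝓘(ℝ, ℝ) ∞ φ) (hw0 : w s = φ)
    {C : ℝ} (hC : ∀ r ∈ Icc s t, ∀ x, |(h r).laplaceBeltrami φ x| ≤ C)
    {r : ℝ} (hr : r ∈ Icc s t) (x : M) : |w r x - φ x| ≤ C * (r - s) := by
  have h2 : (2 : ℕ∞ω) ≤ (∞ : ℕ∞ω) := WithTop.coe_le_coe.mpr le_top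
  set T := t - s with hT
  have hTpos : 0 < T := sub_pos.2 hst
  have key := hw.comp_add_const s
  simp only [sub_self] at key
  -- the translated family and solution
  have hgR : ∀ r' ∈ Icc 0 T, (h (r' + s)).IsRiemannian := fun r' _ ↦ hR _
  have hws : ∀ r' ∈ Icc 0 T, ContMDiff I 𝓘(ℝ, ℝ) ∞ (fun y ↦ w (r' + s) y) := fun r' hr' ↦
    contMDiff_slice_of_contMDiffOn (u := fun r y ↦ w (r + s) y) key.1 hr'
  -- the zero comparison data
  have hF : ContDiffOn ℝ 1 (uncurry fun (_ _ : ℝ) ↦ (0 : ℝ)) (univ ×ˢ Icc 0 T) := contDiffOn_const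
  have hφode : ∀ r' ∈ Icc 0 T, HasDerivWithinAt (fun _ : ℝ ↦ (0 : ℝ))
      ((fun (_ _ : ℝ) ↦ (0 : ℝ)) ((fun _ : ℝ ↦ (0 : ℝ)) r') r') (Icc 0 T) r' := fun r' _ ↦
    hasDerivWithinAt_const _ _ _
  set X : ℝ → (y : M) → TangentSpace I y := fun _ _ ↦ 0 with hX
  -- Laplacians of the comparison functions
  have hΔ : ∀ (c : ℝ), ∀ r' ∈ Icc 0 T, ∀ y, (h (r' + s)).laplaceBeltrami
      (fun y ↦ w (r' + s) y - φ y - c) y =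
      (h (r' + s)).laplaceBeltrami (fun y ↦ w (r' + s) y) y - (h (r' + s)).laplaceBeltrami φ y := by
    intro c r' hr' y
    have e1 : (fun y ↦ w (r' + s) y - φ y - c) = (fun y ↦ w (r' + s) y - φ y) - fun _ ↦ c := rfl
    have e2 : (fun y ↦ w (r' + s) y - φ y) = (fun y ↦ w (r' + s) y) - φ := rfl
    rw [e1, laplaceBeltrami_sub _ ((((hws r' hr').sub hφ).of_le h2) y) contMDiffAt_const,
      laplaceBeltrami_const_fun, sub_zero, e2,
      laplaceBeltrami_sub _ (((hws r' hr').of_le h2) y) ((hφ.of_le h2) y)]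
  -- upper bound: `u = w − φ − C r'` satisfies `∂u ≤ Δu`, `u(0) = 0`
  have hup : ∀ r' ∈ Icc 0 T, ∀ y, w (r' + s) y - φ y - C * r' ≤ 0 := by
    have hu : ContMDiffOn (I.prod 𝓘(ℝ, ℝ)) 𝓘(ℝ, ℝ) ∞
        (fun p : M × ℝ ↦ (fun r' y ↦ w (r' + s) y - φ y - C * r') p.2 p.1) (univ ×ˢ Icc 0 T) :=
      (key.1.sub ((hφ.comp contMDiff_fst).contMDiffOn)).sub
        ((contMDiff_const.mul contMDiff_snd).contMDiffOn)
    have hineq : ∀ r' ∈ Icc 0 T, ∀ y : M,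
        derivWithin (fun r'' ↦ (fun r' y ↦ w (r' + s) y - φ y - C * r') r'' y) (Icc 0 T) r' ≤
          (h (r' + s)).laplaceBeltrami ((fun r' y ↦ w (r' + s) y - φ y - C * r') r') y +
            mvfderiv I ((fun r' y ↦ w (r' + s) y - φ y - C * r') r') y (X r' y) +
            (fun (_ _ : ℝ) ↦ (0 : ℝ)) ((fun r' y ↦ w (r' + s) y - φ y - C * r') r' y) r' := by
      intro r' hr' y
      have hd : HasDerivWithinAt (fun r'' ↦ w (r'' + s) y - φ y - C * r'')
          ((h (r' + s)).laplaceBeltrami (fun y ↦ w (r' + s) y) y - C) (Icc 0 T) r' := by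
        have hd0 := ((key.2 r' hr' y).sub_const (φ y)).sub
          ((hasDerivWithinAt_id r' (Icc 0 T)).const_mul C)
        simp only [id, mul_one] at hd0
        exact hd0
      simp only [hX, map_zero, add_zero]
      rw [hd.derivWithin (uniqueDiffOn_Icc hTpos r' hr'), hΔ (C * r') r' hr' y]
      linarith [(abs_le.1 (hC (r' + s) ⟨by linarith [hr'.1], by linarith [hr'.2]⟩ y)).2]
    intro r' hr' y
    have := weakMaximumPrinciple (α := 0) hTpos hgR X hF hu hineq hφode rfl
      (fun y ↦ by simp [hw0]) r' hr' y
    simpa using this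
  -- lower bound: `u = w − φ + C r'` satisfies `∂u ≥ Δu`, `u(0) = 0`
  have hlow : ∀ r' ∈ Icc 0 T, ∀ y, 0 ≤ w (r' + s) y - φ y - (-C) * r' := by
    have hu : ContMDiffOn (I.prod 𝓘(ℝ, ℝ)) 𝓘(ℝ, ℝ) ∞
        (fun p : M × ℝ ↦ (fun r' y ↦ w (r' + s) y - φ y - (-C) * r') p.2 p.1) (univ ×ˢ Icc 0 T) :=
      (key.1.sub ((hφ.comp contMDiff_fst).contMDiffOn)).sub
        ((contMDiff_const.mul contMDiff_snd).contMDiffOn)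
    have hineq : ∀ r' ∈ Icc 0 T, ∀ y : M,
        (h (r' + s)).laplaceBeltrami ((fun r' y ↦ w (r' + s) y - φ y - (-C) * r') r') y +
            mvfderiv I ((fun r' y ↦ w (r' + s) y - φ y - (-C) * r') r') y (X r' y) +
            (fun (_ _ : ℝ) ↦ (0 : ℝ)) ((fun r' y ↦ w (r' + s) y - φ y - (-C) * r') r' y) r' ≤
          derivWithin (fun r'' ↦ (fun r' y ↦ w (r' + s) y - φ y - (-C) * r') r'' y) (Icc 0 T) r' := by
      intro r' hr' y
      have hd : HasDerivWithinAt (fun r'' ↦ w (r'' + s) y - φ y - (-C) * r'')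
          ((h (r' + s)).laplaceBeltrami (fun y ↦ w (r' + s) y) y - (-C)) (Icc 0 T) r' := by
        have hd0 := ((key.2 r' hr' y).sub_const (φ y)).sub
          ((hasDerivWithinAt_id r' (Icc 0 T)).const_mul (-C))
        simp only [id, mul_one] at hd0
        exact hd0
      simp only [hX, map_zero, add_zero]
      rw [hd.derivWithin (uniqueDiffOn_Icc hTpos r' hr'), hΔ ((-C) * r') r' hr' y]
      linarith [abs_le.1 (hC (r' + s) ⟨by linarith [hr'.1], by linarith [hr'.2]⟩ y)]
    intro r' hr' y
    have := weakMinimumPrinciple (α := 0) hTpos hgR X hF hu hineq hφode rfl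
      (fun y ↦ by simp [hw0]) r' hr' y
    simpa using this
  have hr' : r - s ∈ Icc 0 T := ⟨by linarith [hr.1], by linarith [hr.2]⟩
  have h1 := hup (r - s) hr' x
  have h2' := hlow (r - s) hr' x
  simp only [sub_add_cancel] at h1 h2'
  rw [abs_le]
  constructor <;> nlinarith [h1, h2', hr.1]

include hh hR in
/-- **`|(P_{s→r}φ)(x) − φ(x)| ≤ C (r − s)`** for smooth `φ` with `|Δ_{h(r')}φ| ≤ C` on `M × [s, t]`,
`r ∈ [s, t]` (`heatValue` form of `IsHeatSolutionOn.abs_sub_initial_le`).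
[cite: Bamler2020Entropy, §2.3] -/
theorem abs_heatValue_sub_self_le {s t : ℝ} {φ : M → ℝ} (hφ : ContMDiff I 𝓘(ℝ, ℝ) ∞ φ)
    {C : ℝ} (hC : ∀ r ∈ Icc s t, ∀ x, |(h r).laplaceBeltrami φ x| ≤ C) {r : ℝ} (hr : r ∈ Icc s t)
    (x : M) : |heatValue h s r x φ - φ x| ≤ C * (r - s) := by
  rcases eq_or_lt_of_le hr.1 with hsr | hsr
  · subst hsr
    simp [heatValue_of_le le_rfl]
  obtain ⟨w, hw, hw0, hwv⟩ := exists_isHeatSolutionOn_heatValue hh hR hsr hφ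
  rw [hwv r ⟨hsr.le, le_rfl⟩ x]
  exact hw.abs_sub_initial_le hR hsr hφ hw0 (fun r' hr' y ↦ hC r' ⟨hr'.1, hr'.2.trans hr.2⟩ y)
    ⟨hsr.le, le_rfl⟩ x

include hh hR in
/-- **Lipschitz continuity of `s ↦ (P_{s→t}φ)(x)` for smooth data**: for `s ≤ s'` in `[a, t]` and
`|Δ_{h(r)}φ| ≤ C` on `M × [a, t]`, `|(P_{s→t}φ)(x) − (P_{s'→t}φ)(x)| ≤ C (s' − s)` (semigroup law
`P_{s→t} = P_{s'→t} P_{s→s'}`, the sup-norm contraction, and `abs_heatValue_sub_self_le`).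
[cite: Bamler2020Entropy, §2.3] -/
theorem abs_heatValue_sub_heatValue_le_of_le {a t s s' : ℝ} {φ : M → ℝ}
    (hφ : ContMDiff I 𝓘(ℝ, ℝ) ∞ φ) {C : ℝ} (hC : ∀ r ∈ Icc a t, ∀ x, |(h r).laplaceBeltrami φ x| ≤ C)
    (hs : s ∈ Icc a t) (hs' : s' ∈ Icc a t) (hss' : s ≤ s') (x : M) :
    |heatValue h s t x φ - heatValue h s' t x φ| ≤ C * (s' - s) := by
  rw [heatValue_trans hh hR hss' hs'.2 x hφ]
  refine abs_heatValue_sub_le hh hR x (contMDiff_heatValue hh hR hφ) hφ fun y ↦ ?_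
  exact abs_heatValue_sub_self_le hh hR hφ (fun r hr z ↦ hC r ⟨hs.1.trans hr.1, hr.2.trans hs'.2⟩ z)
    ⟨hss', le_rfl⟩ y

include hh hR in
/-- **`s ↦ (P_{s→t}φ)(x)` is continuous on `ℝ` for smooth `φ`** (Lipschitz on every `[a, t]`, and
constant `= φ(x)` for `s ≥ t`). [cite: Bamler2020Entropy, §2.3] -/
theorem continuous_heatValue_left {t : ℝ} (x : M) {φ : M → ℝ} (hφ : ContMDiff I 𝓘(ℝ, ℝ) ∞ φ) :
    Continuous fun s ↦ heatValue h s t x φ := by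
  refine continuous_iff_continuousAt.2 fun s₀ ↦ ?_
  obtain ⟨C, hC0, hC⟩ := exists_bound_laplaceBeltrami_family hh hφ (s₀ - 1) t
  rw [ContinuousAt, Metric.tendsto_nhds]
  intro ε hε
  have hδ : 0 < min 1 (ε / (C + 1)) := lt_min one_pos (by positivity)
  filter_upwards [Metric.ball_mem_nhds s₀ hδ] with s hs
  rw [Metric.mem_ball, Real.dist_eq] at hs
  have hs1 : |s - s₀| < 1 := hs.trans_le (min_le_left _ _)
  have hs2 : |s - s₀| < ε / (C + 1) := hs.trans_le (min_le_right _ _)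
  rw [Real.dist_eq]
  -- both values are `φ x` past `t`; otherwise the Lipschitz bound on `[s₀ - 1, t]`
  have key : ∀ u v : ℝ, |u - s₀| < 1 → |v - s₀| < 1 → u ≤ v → |u - v| < ε / (C + 1) →
      |heatValue h u t x φ - heatValue h v t x φ| < ε := by
    intro u v hu hv huv huv'
    by_cases hvt : t ≤ v
    · rw [heatValue_of_le hvt]
      by_cases hut : t ≤ u
      · rw [heatValue_of_le hut, sub_self, abs_zero]; exact hε
      · push Not at hut
        have hb := abs_heatValue_sub_self_le hh hR (s := u) (t := t) hφ
          (fun r hr z ↦ hC r ⟨by linarith [hr.1, (abs_lt.1 hu).1], hr.2⟩ z) ⟨hut.le, le_rfl⟩ x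
        calc |heatValue h u t x φ - φ x| ≤ C * (t - u) := hb
          _ ≤ C * (v - u) := by gcongr
          _ < ε := by
            have h3 : v - u < ε / (C + 1) := by rw [abs_sub_comm] at huv'; linarith [(abs_lt.1 huv').2]
            calc C * (v - u) ≤ (C + 1) * (v - u) := by nlinarith
              _ < (C + 1) * (ε / (C + 1)) := by gcongr
              _ = ε := by field_simp
    · push Not at hvt
      have hb := abs_heatValue_sub_heatValue_le_of_le hh hR (a := s₀ - 1) hφ hC
        ⟨by linarith [(abs_lt.1 hu).1], huv.trans hvt.le⟩ ⟨by linarith [(abs_lt.1 hv).1], hvt.le⟩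
        huv x
      calc |heatValue h u t x φ - heatValue h v t x φ| ≤ C * (v - u) := hb
        _ < ε := by
          have h3 : v - u < ε / (C + 1) := by rw [abs_sub_comm] at huv'; linarith [(abs_lt.1 huv').2]
          calc C * (v - u) ≤ (C + 1) * (v - u) := by nlinarith
            _ < (C + 1) * (ε / (C + 1)) := by gcongr
            _ = ε := by field_simp
  rcases le_total s s₀ with hle | hle
  · exact key s s₀ hs1 (by simp) hle hs2
  · rw [abs_sub_comm]
    exact key s₀ s (by simp) hs1 hle (by rw [abs_sub_comm]; exact hs2)

include hh hR in
/-- **`s ↦ (P_{s→t}φ)(x)` is continuous for continuous `φ`** (uniform limit in `s` of the smooth-data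
propagations of the uniform approximants). [cite: Bamler2020Entropy, §2.3] -/
theorem continuous_heatValueC_left {t : ℝ} (x : M) {φ : M → ℝ} (hφ : Continuous φ) :
    Continuous fun s ↦ heatValueC h s t x φ := by
  have hunif : TendstoUniformly (fun n s ↦ heatValue h s t x (smoothApprox I φ n))
      (fun s ↦ heatValueC h s t x φ) atTop := by
    rw [Metric.tendstoUniformly_iff]
    intro ε hε
    obtain ⟨N, hN⟩ := exists_nat_one_div_lt hε
    refine eventually_atTop.2 ⟨N, fun n hn s ↦ ?_⟩
    rw [Real.dist_eq, abs_sub_comm]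
    have hb := abs_heatValue_sub_heatValueC_le hh hR (s := s) (t := t) x hφ
      (contMDiff_smoothApprox hφ n) fun z ↦ (abs_smoothApprox_sub_lt (I := I) hφ n z).le
    have hn' : 1 / ((n : ℝ) + 1) ≤ 1 / ((N : ℝ) + 1) :=
      one_div_le_one_div_of_le (by positivity) (by exact_mod_cast Nat.add_le_add_right hn 1)
    linarith
  exact hunif.continuous (Frequently.of_forall fun n ↦
    continuous_heatValue_left hh hR x (contMDiff_smoothApprox hφ n))

include hh hR in
/-- For `t ≤ s` the continuous-data propagation is the junk value `φ x` (the smooth approximants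
converge to `φ` and their propagations are junk). [folklore] -/
theorem heatValueC_of_le {s t : ℝ} (hts : t ≤ s) (x : M) {φ : M → ℝ} (hφ : Continuous φ) :
    heatValueC h s t x φ = φ x := by
  have h1 := tendsto_heatValue_smoothApprox hh hR s t x hφ
  simp only [heatValue_of_le hts] at h1
  have h2 : Tendsto (fun n ↦ smoothApprox I φ n x) atTop (𝓝 (φ x)) := by
    rw [tendsto_iff_norm_sub_tendsto_zero]
    refine squeeze_zero (fun n ↦ norm_nonneg _) (fun n ↦ ?_)
      (tendsto_one_div_add_atTop_nhds_zero_nat (𝕜 := ℝ))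
    rw [Real.norm_eq_abs]
    exact (abs_smoothApprox_sub_lt (I := I) hφ n x).le
  exact tendsto_nhds_unique h1 h2

include hh hR in
/-- **`s ↦ ∫ φ dν_{x,t;s}` is continuous on `ℝ` for continuous `φ`** (for `s < t` it is
`(P_{s→t}φ)(x)`, for `s ≥ t` the constant `φ(x)`, and the two agree in the limit `s ↗ t`:
`ν_{x,t;s} → δ_x`, Bamler 2020a §2.3). [cite: Bamler2020Entropy, §2.3] -/
theorem continuous_integral_heatKernelMeasure_left (t : ℝ) (x : M) {φ : M → ℝ}
    (hφ : Continuous φ) :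
    Continuous fun s ↦ ∫ y, φ y ∂(heatKernelMeasure hh hR t x s) := by
  have heq : (fun s ↦ ∫ y, φ y ∂(heatKernelMeasure hh hR t x s)) = fun s ↦ heatValueC h s t x φ := by
    funext s
    rcases lt_or_ge s t with hst | hts
    · exact integral_heatKernelMeasure hh hR hst x hφ
    · rw [heatKernelMeasure_of_le hh hR hts, integral_dirac, heatValueC_of_le hh hR hts x hφ]
  rw [heq]
  exact continuous_heatValueC_left hh hR x hφ

include hh hR in
/-- **Measurability of `s ↦ ν_{x,t;s}`** as a measure-valued map (closed sets approximated by
continuous functions and a π-λ argument, as for `measurable_heatKernelMeasure`).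
[cite: Bamler2023, §3.1, Def. 3.2] -/
theorem measurable_heatKernelMeasure_left (t : ℝ) (x : M) :
    Measurable fun s ↦ heatKernelMeasure hh hR t x s := by
  haveI : MetrizableSpace M := Manifold.metrizableSpace I M
  refine Measure.measurable_of_measurable_coe _ fun S hS ↦ ?_
  induction S, hS using MeasurableSpace.induction_on_inter
    ((BorelSpace.measurable_eq (α := M)).trans borel_eq_generateFrom_isClosed)
    isPiSystem_isClosed with
  | empty => simp
  | basic F hF =>
    have hF' : IsClosed F := hF
    refine ENNReal.measurable_of_tendsto
      (f := fun n s ↦ ∫⁻ y, hF'.apprSeq n y ∂(heatKernelMeasure hh hR t x s)) (fun n ↦ ?_) ?_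
    · have hcont : Continuous fun y ↦ ((hF'.apprSeq n y : ℝ≥0) : ℝ) :=
        NNReal.continuous_coe.comp (hF'.apprSeq n).continuous
      have e : (fun s ↦ ∫⁻ y, hF'.apprSeq n y ∂(heatKernelMeasure hh hR t x s)) = fun s ↦
          ENNReal.ofReal (∫ y, ((hF'.apprSeq n y : ℝ≥0) : ℝ) ∂(heatKernelMeasure hh hR t x s)) := by
        funext s
        exact lintegral_coe_eq_integral _ ((hF'.apprSeq n).integrable_of_nnreal _)
      rw [e]
      exact ENNReal.measurable_ofReal.comp
        (continuous_integral_heatKernelMeasure_left hh hR t x hcont).measurable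
    · exact tendsto_pi_nhds.2 fun s ↦ HasOuterApproxClosed.tendsto_lintegral_apprSeq hF' _
  | compl S hS ih =>
    have e : (fun s ↦ heatKernelMeasure hh hR t x s Sᶜ) =
        fun s ↦ 1 - heatKernelMeasure hh hR t x s S := by
      funext s
      exact prob_compl_eq_one_sub hS
    rw [e]
    exact measurable_const.sub ih
  | iUnion f hdisj hfm ih =>
    have e : (fun s ↦ heatKernelMeasure hh hR t x s (⋃ i, f i)) =
        fun s ↦ ∑' i, heatKernelMeasure hh hR t x s (f i) := by
      funext s
      exact measure_iUnion hdisj hfm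
    rw [e]
    exact Measurable.tsum ih

end TimeRegularity

end Literature.Geometry.Riemannian

end
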